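import Summits.Ventures.PercRepro.RankLevelSetLevelSixT16Assembly
import Summits.Ventures.PercRepro.RankLevelSetLevelSixT15Core
import Summits.Ventures.PercRepro.RankLevelSetLevelSixT14Core
import Summits.Ventures.PercRepro.RankLevelSetLevelSixT13Core
import Summits.Ventures.PercRepro.RankLevelSetLevelSixT12Core
import Summits.Ventures.PercRepro.RankLevelSetLevelSixT11Core
import Summits.Ventures.PercRepro.RankLevelSetLevelSixT10Core
import Summits.Ventures.PercRepro.RankLevelSetLevelSixT9Core
import Summits.Ventures.PercRepro.GenQEightSixAssembly

/-!
# PercRepro — THE ROWS 15 … 9 OF LEVEL `6`: `c025_six_large_<word> (P ≤ p) : RLS M p 6` FOR `P = 15, …, 9`, AND THE WHOLE LEVEL-`6` ROW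
`c025_six_all (8 ≤ p)` (p7 g22, S3 feeder; p8's assembly shape)

Each row from the row above (p8's 16 row `c025_six_large_sixteen`) and its core (`c025_six_large_<word>_of_<next>`, the T<P>Core modules:
the cells by the coloop device with the lossy ladder, the middle key beyond `d₀`, `rls_six_at_of_core` on `c025_five_all`); the row `8` is
night-4's `rls_eight_six`. Hence C-025 at level `6` for EVERY `p ≥ 8 = q + 2`, every finite matroid: the q = 6 window is empty.
Axioms: standard.
-/

open scoped Matroid

namespace PercRepro

namespace ThmN

variable {α : Type}

/-- **THE 15 ROW**: C-025 at level `6` for every `p ≥ 15`, every finite matroid. -/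
theorem c025_six_large_fifteen (M : Matroid α) [M.Finite] (p : ℕ) (hp : 15 ≤ p) : RLS M p 6 :=
  c025_six_large_fifteen_of_sixteen (fun M _ p hp => c025_six_large_sixteen M p hp) M p hp

/-- **THE 14 ROW**: C-025 at level `6` for every `p ≥ 14`, every finite matroid. -/
theorem c025_six_large_fourteen (M : Matroid α) [M.Finite] (p : ℕ) (hp : 14 ≤ p) : RLS M p 6 :=
  c025_six_large_fourteen_of_fifteen (fun M _ p hp => c025_six_large_fifteen M p hp) M p hp

/-- **THE 13 ROW**: C-025 at level `6` for every `p ≥ 13`, every finite matroid. -/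
theorem c025_six_large_thirteen (M : Matroid α) [M.Finite] (p : ℕ) (hp : 13 ≤ p) : RLS M p 6 :=
  c025_six_large_thirteen_of_fourteen (fun M _ p hp => c025_six_large_fourteen M p hp) M p hp

/-- **THE 12 ROW**: C-025 at level `6` for every `p ≥ 12`, every finite matroid. -/
theorem c025_six_large_twelve (M : Matroid α) [M.Finite] (p : ℕ) (hp : 12 ≤ p) : RLS M p 6 :=
  c025_six_large_twelve_of_thirteen (fun M _ p hp => c025_six_large_thirteen M p hp) M p hp

/-- **THE 11 ROW**: C-025 at level `6` for every `p ≥ 11`, every finite matroid. -/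
theorem c025_six_large_eleven (M : Matroid α) [M.Finite] (p : ℕ) (hp : 11 ≤ p) : RLS M p 6 :=
  c025_six_large_eleven_of_twelve (fun M _ p hp => c025_six_large_twelve M p hp) M p hp

/-- **THE 10 ROW**: C-025 at level `6` for every `p ≥ 10`, every finite matroid. -/
theorem c025_six_large_ten (M : Matroid α) [M.Finite] (p : ℕ) (hp : 10 ≤ p) : RLS M p 6 :=
  c025_six_large_ten_of_eleven (fun M _ p hp => c025_six_large_eleven M p hp) M p hp

/-- **THE 9 ROW**: C-025 at level `6` for every `p ≥ 9`, every finite matroid. -/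
theorem c025_six_large_nine (M : Matroid α) [M.Finite] (p : ℕ) (hp : 9 ≤ p) : RLS M p 6 :=
  c025_six_large_nine_of_ten (fun M _ p hp => c025_six_large_ten M p hp) M p hp

/-- **THE WHOLE LEVEL-`6` ROW OF C-025**: `RLS M p 6` for every finite matroid and every `p ≥ 8`. -/
theorem c025_six_all (M : Matroid α) [M.Finite] (p : ℕ) (hp : 8 ≤ p) : RLS M p 6 := by
  classical
  rcases Nat.lt_or_ge p 9 with hlt | hge
  · have hP : p = 8 := by omega
    subst hP
    exact Night4.rls_eight_six M
  · exact c025_six_large_nine M p hge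

end ThmN

end PercRepro
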